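import Summits.ResolutionOfSingularities.ResolutionOfSingularities.Theorems.EquisingularLiftEquisingularLiftNatBlowupDisjointTransport
import Summits.ResolutionOfSingularities.ResolutionOfSingularities.Theorems.EquisingularLiftEquisingularLiftNatFatPointStep
import Summits.ResolutionOfSingularities.ResolutionOfSingularities.Theorems.EquisingularLiftEquisingularLiftNatModelPointStepOfSection
import Summits.ResolutionOfSingularities.ResolutionOfSingularities.Theorems.EquisingularLiftEquisingularLiftNatStalkDimension
import Summits.ResolutionOfSingularities.ResolutionOfSingularities.Theorems.EquisingularLiftEquisingularLiftChainRegular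
import Literature.AlgebraicGeometry.Resolution.PointBlowupHsFunMono
import Literature.AlgebraicGeometry.Resolution.GenericPointStalkData
import Literature.AlgebraicGeometry.Resolution.ArithmeticalThreefolds
import Literature.AlgebraicGeometry.Resolution.ExceptionalDivisorRegularGlobal
import Literature.AlgebraicGeometry.Resolution.HypersurfaceMaxOrderTransform
import HarnessLib

/-!
# [OURS · L1 W4.5(b) · EL♮(3)] Rung TOWER₀, brick `towerPtRam_brick` part 2 — THE (pt-ram) STEP AT STAGE LEVEL WITH THE BOOKKEEPING
# AND THE OFF-CENTRE TRANSPORT OF THE EXCEPTIONAL SURFACE / CONE SHADOW (K5-FAT MEMBER CLAUSE, res-type-032 sizing (d))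
# (crux `EquisingularLiftNatThree` = stmt-ResolutionOfSingularities-20148, parent `EquisingularLiftNat` = stmt-…-20038; registered stub
# `stub_elnat_ratTowerPointResolution`, upstairs debt HSUB′(ReachTower₀)₃, constructor `TowerPtRam` of …NatTowerDefs p541504)

HONEST FRAMING. OURS (cell res-hironaka, crux chain w45b, slot W4.5(b)); NOT a statement of any manuscript; AI-written, weaker than expert
review. Helper `--supports stmt-ResolutionOfSingularities-20148 --as helper`; closes nothing; no `sorry`; standard axioms; DEF-FREE.
res-L1-w45b-stub-4, object `towerPtRam_brick` (res-L1-w45b-plan-1 NAMING 2026-08-27T16:37:19Z (a); res-D-pv-029 g8 16:49:44Z (a): «from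
`Tower.Inv₁ … G γ T E K` at a (pt-ram) point produce `Tower.Inv₁` for BOTH conclusions of `TowerPtRam`, shadow `∅` when `y ∈ closure K`,
`E` transported only when `y ∉ E`»). This file is the Member-PACKAGING-FREE mathematics; the `Tower.Inv₁` wrapper (one `obtain` / one
`refine` over this file) follows res-D-pv-029's `…NatTowerInvDefs` the moment it elaborates.

WHAT.
* `fatPointStep_model` — res-L1-w45b-stub-2's `fatPointStep` (…NatFatPointStep, p547071: T-FATCENTRE `exists_fatCentre` ∘ res-D-pv-029's
  `modelStep`) in the binders of the HSUB′ drivers (a `Ch`-stage `(X′, σ′, S′)` refining `Split.Chain`, integral and dominant over `Spec O`;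
  the model square `j : F → X′` over `Spec θ` with `j '' T = S′`; a point `y ∈ T`, `T ⊄ {y}`, `σ′ (j y)` not generic in `Y`; the
  curvilinear fat point `J` at `y` and its blow-up `υ : F₂ → F`) WITH res-type-032's sizing-(d) bookkeeping DISCHARGED: the dimension
  `dim 𝒪_{X′, j y} = n + 1` (…NatStalkDimension), properness of the stage (`chain_isRegular`), `C ≠ ⊥`, `J ≠ ⊥`, `X″` integral
  (`IsBlowup.isIntegral`) and dominant, proper over `Spec O`, `F₂` integral and locally Noetherian, the new running set
  `closure υ⁻¹(T ∖ {y})` irreducible (`isIrreducible_of_model`), and — the input of every transport — **every closed subscheme of the stage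
  not through `j y` MISSES THE CENTRE** (`disjoint_support_of_inter_fibre_eq_singleton`, part 1).
* `fatPointStep_newExceptional` — the NEW exceptional surface `E ↦ υ⁻¹{y}` of conclusion (I): upstairs `V(C·𝒪_{X″})` is locally
  principal and REGULAR (Liu 8.1.19 (b)), with trace `J·𝒪_{F₂}` (support `υ⁻¹{y}`; not reduced for a fat `J` — (F5)).
* `fatPointStep_transport` — for such a subscheme `V(I)` with special-fibre trace `I·𝒪_F = 𝓘⟨closure K⟩`, `y ∉ closure K` (the
  exceptional surface `𝓔` when `y ∉ E`, the cone shadow `𝒦` when `y ∉ closure K` — RULING-5 γ-forget): `V(I·𝒪_{X″}) ≅ V(I)` over `τ`,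
  `St_τ I = I·𝒪_{X″}`, regularity and principal stalks carried, and the new trace `(I·𝒪_{X″})·𝒪_{F₂} = 𝓘⟨closure υ⁻¹(K ∖ {y})⟩` =
  the `TowerPtRam` update `K ↦ closure υ₂⁻¹(K ∖ {y})` / `E ↦ closure υ₂⁻¹(E ∖ {y})` (part 1 (E1)–(E4)).

References: Q. Liu, *Algebraic Geometry and Arithmetic Curves* (2002), §8.1, Thm. 8.1.19 [Liu2002]; U. Görtz, T. Wedhorn, *Algebraic Geometry I*
(2020), Prop. 13.91, (13.19) [GortzWedhorn2020]; The Stacks Project, Tags 02OS, 0805 [StacksProject] — through the cited tree files. OURS planning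
texts (index only): res-type-032 K5-FAT SIZING 2026-08-27T12:47:12Z (d); res-D-pv-029 16:31:11Z §B/§F, 16:37:13Z (F5), 16:49:44Z (a).
-/

set_option linter.dupNamespace false -- mandated namespace `Summit.<Summit>.<Problem>` of this single-conjunct summit
set_option linter.overlappingInstances false -- the binders carry `[IsDomain O] [IsDiscreteValuationRing O]`

noncomputable section

open CategoryTheory CategoryTheory.Limits AlgebraicGeometry TopologicalSpace Topology IsLocalRing
open Literature.AlgebraicGeometry.Resolution
open AlgebraicGeometry.Scheme.IdealSheafData
open Summit.ResolutionOfSingularities.ResolutionOfSingularities.Theses.EquisingularLift.Split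
open Summit.ResolutionOfSingularities.ResolutionOfSingularities.Cruxes.EquisingularLift.StrataSplit

namespace Summit.ResolutionOfSingularities.ResolutionOfSingularities.Cruxes.EquisingularLiftNat.Sections

/-- **THE (pt-ram) STEP AT STAGE LEVEL, WITH THE BOOKKEEPING** (see the module docstring): res-L1-w45b-stub-2's `fatPointStep` in the
binders of the HSUB′ drivers, plus `dim 𝒪_{X′,j y} = n + 1`, properness, `X″` integral / dominant / proper over `Spec O`, `F₂` integral
and locally Noetherian, the strict transform `closure υ⁻¹(T ∖ {y})` irreducible, and «every closed subscheme of the stage not through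
`j y` misses the centre». [cite: Liu2002, §8.1 and Thm. 8.1.19] [cite: StacksProject, Tag 0805] [OURS · L1 W4.5b · towerPtRam_brick] -/
theorem fatPointStep_model (O : Type) [CommRing O] [IsDomain O] [IsDiscreteValuationRing O] [IsAdicComplete (maximalIdeal O) O]
    [IsAlgClosed (ResidueField O)] (k : Type) [Field k] (θ : O →+* k) (hθ : Function.Surjective θ)
    (P : Scheme.{0}) (q : P ⟶ Spec (.of O)) (Y : Set P) (hYsp : Y ⊆ q ⁻¹' {closedPoint O}) (hYirr : IsIrreducible Y)
    (hYcl : IsClosed Y) [IsProper q] [IsIntegral P] (hPnoeth : IsLocallyNoetherian P) (hPreg : Scheme.IsRegular P)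
    (n : ℕ) [SmoothOfRelativeDimension n q]
    (Ch : ∀ X' : Scheme.{0}, (X' ⟶ P) → Set X' → Prop)
    (hChain : ∀ (X' : Scheme.{0}) (σ : X' ⟶ P) (S : Set X'), Ch X' σ S → Chain P Y X' σ S)
    (hStep : ∀ (X' X'' : Scheme.{0}) (σ' : X' ⟶ P) (S' : Set X') (C : X'.IdealSheafData) (τ : X'' ⟶ X'),
      Ch X' σ' S' → IsBlowup τ C → Scheme.IsRegular C.subscheme → Flat (C.subschemeι ≫ σ' ≫ q) →
      σ' '' (C.support : Set X') ⊆ {x : P | ¬ IsGenericPoint x Y} →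
      (C.support : Set X') ∩ (σ' ≫ q) ⁻¹' {closedPoint O} ⊆ S' →
      Ch X'' (τ ≫ σ') (closure (τ ⁻¹' (S' \ (C.support : Set X')))))
    -- the upstairs stage
    (X' : Scheme.{0}) (σ' : X' ⟶ P) (S' : Set X') (hCh : Ch X' σ' S') [IsIntegral X'] (hdom : IsDominant (σ' ≫ q))
    -- the downstairs stage and the model square
    (F : Scheme.{0}) [IsIntegral F] (j : F ⟶ X') (t : F ⟶ Spec (.of k))
    (hsq : IsPullback j t (σ' ≫ q) (Spec.map (CommRingCat.ofHom θ)))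
    (T : Set F) (hTS : j '' T = S')
    -- the point of the fat step
    (y : F) (hyT : y ∈ T) (hTy : ¬ T ⊆ {y}) (hyoff : ¬ IsGenericPoint (σ' (j y)) Y)
    -- the curvilinear fat point
    (J : F.IdealSheafData) (hJsupp : (J.support : Set F) = {y})
    (ℓ : Fin n → F.presheaf.stalk y) (hℓ : ∀ i, ℓ i ∈ maximalIdeal (F.presheaf.stalk y))
    (hJℓ : stalkIdeal J y = Ideal.span (Set.range ℓ))
    (hli : LinearIndependent (ResidueField (F.presheaf.stalk y)) fun i => (maximalIdeal (F.presheaf.stalk y)).toCotangent ⟨ℓ i, hℓ i⟩)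
    -- the downstairs blow-up of the fat point
    (F₂ : Scheme.{0}) (υ : F₂ ⟶ F) (hυ : IsBlowup υ J) :
    ∃ (C : X'.IdealSheafData) (X'' : Scheme.{0}) (τ : X'' ⟶ X') (j₂ : F₂ ⟶ X'') (t₂ : F₂ ⟶ Spec (.of k)),
      IsBlowup τ C ∧ C.comap j = J ∧ Scheme.IsRegular C.subscheme ∧ Flat (C.subschemeι ≫ σ' ≫ q) ∧
      (C.support : Set X') ∩ (σ' ≫ q) ⁻¹' {closedPoint O} = {j y} ∧
      (∀ I : X'.IdealSheafData, j y ∉ (I.support : Set X') → Disjoint (I.support : Set X') (C.support : Set X')) ∧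
      Ch X'' (τ ≫ σ') (closure (τ ⁻¹' (S' \ (C.support : Set X')))) ∧
      Scheme.IsRegular X'' ∧ IsLocallyNoetherian X'' ∧ IsIntegral X'' ∧ IsDominant ((τ ≫ σ') ≫ q) ∧
      IsProper ((τ ≫ σ') ≫ q) ∧ IsLocallyNoetherian X' ∧ IsLocallyNoetherian F ∧
      IsIntegral F₂ ∧ IsLocallyNoetherian F₂ ∧ IsIrreducible (closure (υ ⁻¹' (T \ {y}))) ∧
      IsPullback j₂ t₂ ((τ ≫ σ') ≫ q) (Spec.map (CommRingCat.ofHom θ)) ∧ j₂ ≫ τ = υ ≫ j ∧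
      j₂ '' closure (υ ⁻¹' (T \ {y})) = closure (τ ⁻¹' (S' \ (C.support : Set X'))) := by
  classical
  -- the stage over `O`: locally Noetherian, regular, proper
  obtain ⟨hX'noeth, hreg, hσ'⟩ := chain_isRegular P Y X' σ' S' (hChain _ _ _ hCh) hPnoeth hPreg
  haveI := hX'noeth
  haveI := hσ'
  haveI hprop : IsProper (σ' ≫ q) := inferInstance
  -- the model square: `j` is a closed immersion onto the special fibre
  haveI : IsClosedImmersion (Spec.map (CommRingCat.ofHom θ)) := IsClosedImmersion.spec_of_surjective _ hθ
  haveI hjci : IsClosedImmersion j := MorphismProperty.IsStableUnderBaseChange.of_isPullback hsq.flip inferInstance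
  have hrangej : Set.range j = (σ' ≫ q) ⁻¹' {closedPoint O} := by
    rw [range_eq_preimage_of_isPullback hsq, range_specMap_of_surjective_of_field θ hθ]
  have hjsp : ∀ z : F, (σ' ≫ q) (j z) = closedPoint O := fun z => by
    have h1 : j z ∈ Set.range j := ⟨z, rfl⟩
    rw [hrangej] at h1
    exact h1
  have hyc : IsClosed ({y} : Set F) := hJsupp ▸ J.support.isClosed
  have hjyc : IsClosed ({j y} : Set X') := by
    have h1 := hjci.isClosedEmbedding.isClosedMap _ hyc
    rwa [Set.image_singleton] at h1
  -- the dimension of the stage at the closed special point `j y`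
  have hξ : IsGenericPoint hYirr.genericPoint Y := hYirr.isGenericPoint_genericPoint hYcl
  have hdim : ringKrullDim (X'.presheaf.stalk (j y)) = ((n + 1 : ℕ) : WithBot ℕ∞) :=
    ringKrullDim_stalk_eq_succ_of_chain q n hξ (hChain _ _ _ hCh) hjyc (by
      simpa only [Scheme.Hom.comp_base, TopCat.coe_comp, Function.comp_apply] using hjsp y)
  -- res-L1-w45b-stub-2's fat-point step (T-FATCENTRE ∘ modelStep)
  obtain ⟨C, X'', τ, j₂, t₂, hτ, hCJ, hCreg, -, hCflat, hCsf, hCh'', hreg'', hnoeth'', hsq₂, hcomm, hsets⟩ :=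
    fatPointStep O k θ hθ P q Y hYsp Ch hStep X' σ' S' hCh hreg hprop F j t hsq T hTS y hyc hyT hdim hyoff J hJsupp ℓ hℓ
      hJℓ hli F₂ υ hυ
  -- the fat point and the centre are proper ideal sheaves (`T` has a point other than `y`)
  have hJne : J ≠ ⊥ := by
    intro h
    apply hTy
    intro z _
    have h1 : z ∈ (J.support : Set F) := by rw [h, Scheme.IdealSheafData.support_bot]; trivial
    rw [hJsupp] at h1
    exact h1
  have hCne : C ≠ ⊥ := by
    intro h
    apply hTy
    intro z _
    have h1 : j z ∈ (C.support : Set X') ∩ (σ' ≫ q) ⁻¹' {closedPoint O} :=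
      ⟨by rw [h, Scheme.IdealSheafData.support_bot]; trivial, hjsp z⟩
    rw [hCsf] at h1
    exact hjci.isClosedEmbedding.injective h1
  -- bookkeeping upstairs
  haveI hint'' : IsIntegral X'' := hτ.isIntegral hCne
  haveI : IsDominant τ := isDominant_of_isBlowup hτ hCne
  haveI := hdom
  have hdom'' : IsDominant ((τ ≫ σ') ≫ q) := by rw [Category.assoc]; infer_instance
  haveI : IsProper τ := hτ.isProper
  have hprop'' : IsProper ((τ ≫ σ') ≫ q) := by rw [Category.assoc]; infer_instance
  -- bookkeeping downstairs
  haveI hF₂ : IsIntegral F₂ := hυ.isIntegral hJne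
  haveI := hnoeth''
  haveI hj₂ci : IsClosedImmersion j₂ := MorphismProperty.IsStableUnderBaseChange.of_isPullback hsq₂.flip inferInstance
  have hT₂irr : IsIrreducible (closure (υ ⁻¹' (T \ {y}))) :=
    isIrreducible_of_model hYirr hYcl (hChain _ _ _ hCh'') j₂ _ isClosed_closure hsets
  haveI hFnoeth : IsLocallyNoetherian F := LocallyOfFiniteType.isLocallyNoetherian j
  haveI : IsProper υ := hυ.isProper
  have hF₂noeth : IsLocallyNoetherian F₂ := LocallyOfFiniteType.isLocallyNoetherian υ
  -- every closed subscheme of the stage not through `j y` misses the centre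
  have hdisj : ∀ I : X'.IdealSheafData, j y ∉ (I.support : Set X') →
      Disjoint (I.support : Set X') (C.support : Set X') :=
    fun I hI => disjoint_support_of_inter_fibre_eq_singleton (σ' ≫ q) C I hCsf hI
  exact ⟨C, X'', τ, j₂, t₂, hτ, hCJ, hCreg, hCflat, hCsf, hdisj, hCh'', hreg'', hnoeth'', hint'', hdom'', hprop'', hX'noeth,
    hFnoeth, hF₂, hF₂noeth, hT₂irr, hsq₂, hcomm, hsets⟩

/-- **OFF-CENTRE TRANSPORT THROUGH THE (pt-ram) STEP** (the `E`- and `K`-clauses of the tower invariant when the blown-up point is off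
them; see the module docstring): in the model square of `fatPointStep_model`, a closed subscheme `V(I)` of the stage with special-fibre
trace `I·𝒪_F = 𝓘⟨closure K⟩`, `y ∉ closure K`, misses the centre; hence `V(I·𝒪_{X″}) ≅ V(I)` over `τ`, `St_τ I = I·𝒪_{X″}`, regularity
and principal stalks are carried, and `(I·𝒪_{X″})·𝒪_{F₂} = 𝓘⟨closure υ⁻¹(K ∖ {y})⟩`. [cite: GortzWedhorn2020, Prop. 13.91 (3) and (13.19)]
[cite: StacksProject, Tag 033B] [OURS · L1 W4.5b · towerPtRam_brick] -/
theorem fatPointStep_transport {X' X'' F F₂ : Scheme.{0}} [IsLocallyNoetherian X'] [IsLocallyNoetherian X'']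
    [IsLocallyNoetherian F] {τ : X'' ⟶ X'} {C : X'.IdealSheafData} (hτ : IsBlowup τ C) {j : F ⟶ X'} {j₂ : F₂ ⟶ X''}
    {υ : F₂ ⟶ F} (hcomm : j₂ ≫ τ = υ ≫ j) {J : F.IdealSheafData} (hυ : IsBlowup υ J) {y : F}
    (hJsupp : (J.support : Set F) = {y})
    (hdisj : ∀ I : X'.IdealSheafData, j y ∉ (I.support : Set X') → Disjoint (I.support : Set X') (C.support : Set X'))
    (I : X'.IdealSheafData) (K : Set F) (hIK : I.comap j = vanishingIdeal ⟨closure K, isClosed_closure⟩)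
    (hyK : y ∉ closure K) :
    Disjoint (I.support : Set X') (C.support : Set X') ∧
    (∃ e : (I.comap τ).subscheme ≅ I.subscheme, e.hom ≫ I.subschemeι = (I.comap τ).subschemeι ≫ τ) ∧
    strictTransformIdeal τ C I = I.comap τ ∧
    (Scheme.IsRegular I.subscheme → Scheme.IsRegular (I.comap τ).subscheme) ∧
    (∀ x : X'', (stalkIdeal I (τ x)).IsPrincipal → (stalkIdeal (I.comap τ) x).IsPrincipal) ∧
    (I.comap τ).comap j₂ = vanishingIdeal ⟨closure (υ ⁻¹' (K \ {y})), isClosed_closure⟩ := by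
  have hjy : j y ∉ (I.support : Set X') := (not_mem_support_iff_of_comap_eq I K hIK y).mpr hyK
  have hd := hdisj I hjy
  exact ⟨hd, exists_iso_subscheme_comap_of_disjoint hτ I hd, strictTransformIdeal_eq_comap_of_disjoint hτ I hd,
    isRegular_subscheme_comap_of_disjoint hτ I hd, fun x hx => isPrincipal_stalkIdeal_comap τ I x hx,
    comap_comap_eq_vanishingIdeal_of_not_mem hcomm hυ hJsupp I K hIK hyK⟩

/-- **THE NEW EXCEPTIONAL SURFACE of the (pt-ram) step** (conclusion (I) of `TowerPtRam`, `E ↦ υ⁻¹{y}`): upstairs it is the exceptional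
divisor `V(C·𝒪_{X″})` of the blow-up along the regular `O`-flat multisection — locally principal (effective Cartier), REGULAR (Liu,
Thm. 8.1.19 (b): `IsBlowup.isRegular_subscheme_comap`), with special-fibre trace `(C·𝒪_{X″})·𝒪_{F₂} = J·𝒪_{F₂}` (the exceptional Cartier
divisor of `Bl_J F` — NOT reduced for a curvilinear `J` of length `≥ 2`, res-D-pv-029 (F5)) whose support is `υ⁻¹{y}`.
[cite: Liu2002, Thm. 8.1.19 (b)] [cite: StacksProject, Tag 01WS] [OURS · L1 W4.5b · towerPtRam_brick] -/
theorem fatPointStep_newExceptional {X' X'' F F₂ : Scheme.{0}} [IsLocallyNoetherian X'] {τ : X'' ⟶ X'} {C : X'.IdealSheafData}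
    (hτ : IsBlowup τ C) (hreg : Scheme.IsRegular X') (hCreg : Scheme.IsRegular C.subscheme) {j : F ⟶ X'} {j₂ : F₂ ⟶ X''}
    {υ : F₂ ⟶ F} (hcomm : j₂ ≫ τ = υ ≫ j) {J : F.IdealSheafData} (hCJ : C.comap j = J) {y : F}
    (hJsupp : (J.support : Set F) = {y}) :
    (∀ x : X'', (stalkIdeal (C.comap τ) x).IsPrincipal) ∧ Scheme.IsRegular (C.comap τ).subscheme ∧
    (C.comap τ).comap j₂ = J.comap υ ∧ ((((C.comap τ).comap j₂).support : Set F₂) = υ ⁻¹' {y}) := by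
  have htr : (C.comap τ).comap j₂ = J.comap υ := by
    rw [← Scheme.IdealSheafData.comap_comp, hcomm, Scheme.IdealSheafData.comap_comp, hCJ]
  refine ⟨fun x => isPrincipal_stalkIdeal_of_isEffectiveCartier hτ.isEffectiveCartier x,
    hτ.isRegular_subscheme_comap hreg hCreg, htr, ?_⟩
  rw [htr, support_comap, ← hJsupp]
  rfl

/-! ## Small inputs of the `Tower.Inv₁` wrapper (downstairs readings of the `TowerPtRam` binders) -/

/-- A point of the reduced curve `V(closure T)_red` lies on `T` when `T` is closed. [folklore] -/
theorem subschemeι_mem_of_isClosed {G : Scheme.{0}} {T : Set G} (hT : IsClosed T)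
    (y : ↥(vanishingIdeal (⟨closure T, isClosed_closure⟩ : Closeds G)).subscheme) :
    ((vanishingIdeal (⟨closure T, isClosed_closure⟩ : Closeds G)).subschemeι y : G) ∈ T := by
  have h1 : ((vanishingIdeal (⟨closure T, isClosed_closure⟩ : Closeds G)).subschemeι y : G) ∈
      Set.range (vanishingIdeal (⟨closure T, isClosed_closure⟩ : Closeds G)).subschemeι := ⟨y, rfl⟩
  rw [range_subschemeι, Scheme.IdealSheafData.coe_support_vanishingIdeal] at h1
  exact hT.closure_subset h1

/-- **`T ⊄ {y}` at a (pt-ram) point**: if the reduced subscheme `V(closure T)_red` is NOT regular at the closed point `y`, then `T` is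
not inside `{y}` (else `V(closure T)_red = Spec κ(y)`, whose local ring is a field). [folklore] -/
theorem not_subset_singleton_of_not_isRegularLocalRing_stalk {G : Scheme.{0}} {T : Set G}
    (y : ↥(vanishingIdeal (⟨closure T, isClosed_closure⟩ : Closeds G)).subscheme)
    (hy : ¬ IsRegularLocalRing ((vanishingIdeal (⟨closure T, isClosed_closure⟩ : Closeds G)).subscheme.presheaf.stalk y))
    (hyc : IsClosed ({((vanishingIdeal (⟨closure T, isClosed_closure⟩ : Closeds G)).subschemeι y : G)} : Set G)) :
    ¬ T ⊆ {((vanishingIdeal (⟨closure T, isClosed_closure⟩ : Closeds G)).subschemeι y : G)} := by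
  intro hT
  apply hy
  have hzT : ((vanishingIdeal (⟨closure T, isClosed_closure⟩ : Closeds G)).subschemeι y : G) ∈ closure T := by
    have h1 : ((vanishingIdeal (⟨closure T, isClosed_closure⟩ : Closeds G)).subschemeι y : G) ∈
        Set.range (vanishingIdeal (⟨closure T, isClosed_closure⟩ : Closeds G)).subschemeι := ⟨y, rfl⟩
    rw [range_subschemeι, Scheme.IdealSheafData.coe_support_vanishingIdeal] at h1
    exact h1
  have hcl : ((⟨closure T, isClosed_closure⟩ : Closeds G) : Set G) =
      closure {((vanishingIdeal (⟨closure T, isClosed_closure⟩ : Closeds G)).subschemeι y : G)} := by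
    change closure T = _
    refine Set.Subset.antisymm ?_ ?_
    · rw [hyc.closure_eq]
      exact closure_minimal hT hyc
    · rw [hyc.closure_eq, Set.singleton_subset_iff]
      exact hzT
  rw [isRegularLocalRing_stalk_subscheme_iff, stalkIdeal_vanishingIdeal_eq_maximalIdeal_of_closure_eq hcl]
  exact isRegularLocalRing_of_isField ((Ideal.Quotient.maximal_ideal_iff_isField_quotient _).mp inferInstance)

/-- **No CLOSED point is generic in `Y`** once one closed point of `Y` is not (e.g. the foot `σ′(s 𝔪)` of the first section): then the image
of any closed point under a closed map is not generic in `Y` — the source of the `Ch`-step's «off the generic point of `Y`» for every later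
point step. [folklore] -/
theorem not_isGenericPoint_of_isClosed {P : Scheme.{0}} {Y : Set P} {p₀ : P} (hp₀Y : p₀ ∈ Y)
    (hgen₀ : ¬ IsGenericPoint p₀ Y) {p : P} (hp : IsClosed ({p} : Set P)) : ¬ IsGenericPoint p Y := by
  intro hgen
  have hY : Y = {p} := by rw [← hgen.def, hp.closure_eq]   -- `IsGenericPoint p Y := closure {p} = Y`
  rw [hY, Set.mem_singleton_iff] at hp₀Y
  subst hp₀Y
  exact hgen₀ hgen

/-- The image of a closed point under a closed map of schemes is a closed point; with `not_isGenericPoint_of_isClosed` this discharges the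
`hyoff` input of `fatPointStep_model`. [folklore] -/
theorem isClosed_singleton_image {X' P : Scheme.{0}} (σ' : X' ⟶ P) (hσ : IsClosedMap σ') {c : X'}
    (hc : IsClosed ({c} : Set X')) : IsClosed ({σ' c} : Set P) := by
  simpa only [Set.image_singleton] using hσ _ hc

end Summit.ResolutionOfSingularities.ResolutionOfSingularities.Cruxes.EquisingularLiftNat.Sections

end
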